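import Literature.Probability.RandomPlanarGeometry.BrownianLoopPieces
import Literature.Probability.RandomPlanarGeometry.BrownianLoopRerooting
import Mathlib.MeasureTheory.Function.FactorsThrough
import HarnessLib

/-!
# The law of an initial segment of planar Brownian motion: Gaussian endpoint, Brownian bridge

Lawler, *Conformally Invariant Processes in the Plane* (2005), §5.2: the measure `μ(z, ·; t)` on
paths of duration `t` started at `z` (planar Brownian motion run for time `t`) disintegrates over
its endpoint as "`μ(z, w; t) = p_t(z, w) μ^#(z, w; t)`", the bridge probability `μ^#(z, w; t)`
being realised by `w ↦ z + (w − z)s/t + [B_s − (s/t)B_t]`. In the tree's unit-time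
parametrisation: **for `t > 0` and measurable `G ≥ 0` of a path `[0,1] → ℂ`,**

  `E[G(v ↦ z + Z_{tv})] = ∫ p_t(w − z) E[G(bridgeFun z w (t, ·))] dA(w)`

(`lintegral_segment_eq`), where `Z` is the planar Brownian motion of the Wiener pair and
`bridgeFun z w (t, ω)(v) = z + v(w − z) + √t η_ω(v)` (`BrownianLoopPieces`). Ingredients:
Brownian scaling `(Z_{tv})_v ∼ (√t Z_v)_v` (Mathlib `IsPreBrownianReal.smul` and the uniqueness
of the path law, `IsPreBrownianReal.map_path_eq`, coordinatewise: `map_brownian_scale`,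
`map_planarSegment_eq_map_scaled`); the decomposition `Z_v = η_v + v Z_1` with `η ⟂ Z_1`
(`indepFun_unitBridge_planarBrownian_one`) and the Gaussian density of `Z_1`
(`map_planarBrownian_one_eq_withDensity`); the affine change of variables
`lintegral_heat_affine`. On path space `C([0,1], ℂ)` (Borel σ-algebra = pull-back of the
product σ-algebra, Billingsley (1999), Example 1.3; Doob–Dynkin factorisation
`exists_eq_comp_coeFn`) the same identity holds for Borel `G` (`lintegral_segmentCM_eq`, with
the bridge as a continuous path `bridgeFunCM`).

## References

* G. F. Lawler, *Conformally Invariant Processes in the Plane*, AMS (2005), §5.2.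
* D. Revuz, M. Yor, *Continuous Martingales and Brownian Motion* (1999), Ch. I Prop. (1.10)
  (scaling).
-/

noncomputable section

open Set MeasureTheory ProbabilityTheory unitInterval
open scoped unitInterval NNReal ENNReal

namespace Literature.Probability.RandomPlanarGeometry

open Literature.Probability.Process (WienerPair wienerPair brownian preWienerMeasure measurable_brownian)

namespace BrownianLoop

/-! ### Brownian scaling -/

/-- **Brownian scaling of the canonical coordinate process, as an identity of path laws**:
`(B_{ts})_s ∼ (√t B_s)_s` on `ℝ≥0 → ℝ` (`t > 0`). [folklore] -/
theorem map_brownian_scale {t : ℝ≥0} (ht : t ≠ 0) :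
    preWienerMeasure.map (fun ω (s : ℝ≥0) ↦ brownian (t * s) ω) =
      preWienerMeasure.map (fun ω (s : ℝ≥0) ↦ Real.sqrt t * brownian s ω) := by
  have hB := isPreBrownianReal_brownian
  have hBc := hB.smul ht
  have hm : ∀ s, Measurable (brownian s) := measurable_brownian
  have hmc : ∀ s : ℝ≥0, Measurable fun ω ↦ (Real.sqrt t)⁻¹ * brownian (t * s) ω :=
    fun s ↦ (hm _).const_mul _
  have hlaw := hBc.map_path_eq hB hmc hm
  have hS : Measurable fun (y : ℝ≥0 → ℝ) (s : ℝ≥0) ↦ Real.sqrt t * y s :=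
    measurable_pi_lambda _ fun s ↦ (measurable_pi_apply s).const_mul _
  have hne : Real.sqrt t ≠ 0 := Real.sqrt_ne_zero'.2 (NNReal.coe_pos.2 (pos_iff_ne_zero.2 ht))
  have e1 : (fun ω (s : ℝ≥0) ↦ brownian (t * s) ω) =
      (fun (y : ℝ≥0 → ℝ) (s : ℝ≥0) ↦ Real.sqrt t * y s) ∘
        fun ω (s : ℝ≥0) ↦ (Real.sqrt t)⁻¹ * brownian (t * s) ω := by
    funext ω s
    simp only [Function.comp_apply, ← mul_assoc, mul_inv_cancel₀ hne, one_mul]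
  have e2 : (fun ω (s : ℝ≥0) ↦ Real.sqrt t * brownian s ω) =
      (fun (y : ℝ≥0 → ℝ) (s : ℝ≥0) ↦ Real.sqrt t * y s) ∘ fun ω (s : ℝ≥0) ↦ brownian s ω := rfl
  rw [e1, e2, ← Measure.map_map hS (measurable_pi_lambda _ hmc),
    ← Measure.map_map hS (measurable_pi_lambda _ hm), hlaw]

/-- Assembling a planar path on `[0,1]` from two real paths. [folklore] -/
def planarOfPair (y : (ℝ≥0 → ℝ) × (ℝ≥0 → ℝ)) (v : I) : ℂ :=
  (y.1 (v : ℝ).toNNReal : ℂ) + (y.2 (v : ℝ).toNNReal : ℂ) * Complex.I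

/-- Measurability of `planarOfPair`. [folklore] -/
theorem measurable_planarOfPair : Measurable planarOfPair := by
  refine measurable_pi_lambda _ fun v ↦ ?_
  unfold planarOfPair
  exact (Complex.measurable_ofReal.comp ((measurable_pi_apply _).comp measurable_fst)).add
    ((Complex.measurable_ofReal.comp ((measurable_pi_apply _).comp measurable_snd)).mul_const _)

/-- `timeOf v = (v : ℝ).toNNReal`. [folklore] -/
theorem timeOf_eq_toNNReal (v : I) : timeOf v = (v : ℝ).toNNReal :=
  NNReal.eq (by rw [Real.coe_toNNReal _ v.2.1]; rfl)

/-- **Brownian scaling of the planar segment**: the law of `v ↦ Z_{tv}` on `[0,1] → ℂ` is the law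
of `v ↦ √t Z_v` (`t > 0`). [folklore] -/
theorem map_planarSegment_eq_map_scaled {t : ℝ≥0} (ht : t ≠ 0) :
    wienerPair.map (fun ω (v : I) ↦ planarBrownian (t * (v : ℝ).toNNReal) ω) =
      wienerPair.map (fun ω (v : I) ↦ (Real.sqrt t : ℂ) * planarBrownian (timeOf v) ω) := by
  haveI := isProbabilityMeasure_preWienerMeasure'
  set φ : (ℝ≥0 → ℝ) → (ℝ≥0 → ℝ) := fun ω s ↦ brownian (t * s) ω with hφ
  set ψ : (ℝ≥0 → ℝ) → (ℝ≥0 → ℝ) := fun ω s ↦ Real.sqrt t * brownian s ω with hψ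
  have hφm : Measurable φ := measurable_pi_lambda _ fun s ↦ measurable_brownian _
  have hψm : Measurable ψ := measurable_pi_lambda _ fun s ↦ (measurable_brownian s).const_mul _
  have e1 : (fun ω (v : I) ↦ planarBrownian (t * (v : ℝ).toNNReal) ω) = planarOfPair ∘ Prod.map φ φ := by
    funext ω v; rfl
  have e2 : (fun ω (v : I) ↦ (Real.sqrt t : ℂ) * planarBrownian (timeOf v) ω) =
      planarOfPair ∘ Prod.map ψ ψ := by
    funext ω v
    simp only [Function.comp_apply, planarOfPair, Prod.map, hψ, planarBrownian, timeOf_eq_toNNReal]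
    push_cast
    ring
  rw [e1, e2, ← Measure.map_map measurable_planarOfPair (hφm.prodMap hφm),
    ← Measure.map_map measurable_planarOfPair (hψm.prodMap hψm), Process.wienerPair,
    ← Measure.map_prod_map _ _ hφm hφm, ← Measure.map_prod_map _ _ hψm hψm, hφ, hψ,
    map_brownian_scale ht]

/-! ### The segment law -/

/-- `heat 1` is the standard planar Gaussian density. [folklore] -/
theorem heat_one_eq (w : ℂ) : heat 1 w = gaussianPDF 0 1 w.re * gaussianPDF 0 1 w.im := by
  rw [heat, Real.toNNReal_one]

/-- **The law of an initial segment of planar Brownian motion** ([Lawler] §5.2,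
`μ(z, ·; t) = ∫ p_t(z, w) μ^#(z, w; t) dA(w)` in unit-time parametrisation): for `t > 0` and
measurable `G ≥ 0` on `[0,1] → ℂ`,
`E[G(v ↦ z + Z_{tv})] = ∫ p_t(w − z) E[G(bridgeFun z w (t, ·))] dA(w)`.
[cite: Lawler2005ConformallyInvariant, §5.2] -/
theorem lintegral_segment_eq {t : ℝ} (ht : 0 < t) (z : ℂ) {G : (I → ℂ) → ℝ≥0∞} (hG : Measurable G) :
    ∫⁻ ω, G (fun v ↦ z + planarBrownian (t.toNNReal * (v : ℝ).toNNReal) ω) ∂wienerPair =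
      ∫⁻ w, heat t (w - z) * ∫⁻ ω, G (bridgeFun z w (t, ω)) ∂wienerPair := by
  have ht' : t.toNNReal ≠ 0 := by simpa [Real.toNNReal_eq_zero, not_le] using ht
  have hsq : Real.sqrt (t.toNNReal : ℝ) = Real.sqrt t := by rw [Real.coe_toNNReal _ ht.le]
  -- Step 1: scaling
  have hGz : Measurable fun x : I → ℂ ↦ G (fun v ↦ z + x v) :=
    hG.comp (measurable_pi_lambda _ fun v ↦ (measurable_pi_apply v).const_add _)
  have hseg : Measurable fun (ω : WienerPair) (v : I) ↦ planarBrownian (t.toNNReal * (v : ℝ).toNNReal) ω :=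
    measurable_pi_lambda _ fun v ↦ measurable_planarBrownian _
  have hsc : Measurable fun (ω : WienerPair) (v : I) ↦ (Real.sqrt t : ℂ) * planarBrownian (timeOf v) ω :=
    measurable_pi_lambda _ fun v ↦ (measurable_planarBrownian _).const_mul _
  have step1 : ∫⁻ ω, G (fun v ↦ z + planarBrownian (t.toNNReal * (v : ℝ).toNNReal) ω) ∂wienerPair =
      ∫⁻ ω, G (fun v ↦ z + (Real.sqrt t : ℂ) * planarBrownian (timeOf v) ω) ∂wienerPair := by
    have h1 := lintegral_map (μ := wienerPair) hGz hseg
    have h2 := lintegral_map (μ := wienerPair) hGz hsc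
    simp only at h1 h2
    rw [← h1, ← h2, map_planarSegment_eq_map_scaled ht', hsq]
  rw [step1]
  -- Step 2: bridge decomposition `Z_v = η_v + v Z_1`, independence and the law of `Z_1`
  set Λ : (I → ℂ) × ℂ → (I → ℂ) := fun x v ↦ z + (Real.sqrt t : ℂ) * (x.1 v + ((v : ℝ) : ℂ) * x.2) with hΛ
  have hΛm : Measurable Λ := measurable_pi_lambda _ fun v ↦ measurable_const.add
    (measurable_const.mul (((measurable_pi_apply v).comp measurable_fst).add
      (measurable_const.mul measurable_snd)))
  have hdec : ∀ ω, (fun v ↦ z + (Real.sqrt t : ℂ) * planarBrownian (timeOf v) ω) =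
      Λ ((fun v : I ↦ unitBridge ω v), planarBrownian 1 ω) := by
    intro ω; funext v
    simp only [hΛ, planarBrownian_timeOf, Complex.real_smul]
  simp_rw [hdec]
  have hU : Measurable fun (ω : WienerPair) (v : I) ↦ unitBridge ω v :=
    measurable_pi_lambda _ fun v ↦ measurable_unitBridge v
  have hZ : Measurable (planarBrownian 1 : WienerPair → ℂ) := measurable_planarBrownian 1
  have hprod : wienerPair.map (fun ω ↦ ((fun v : I ↦ unitBridge ω v), planarBrownian 1 ω)) =
      (wienerPair.map fun ω (v : I) ↦ unitBridge ω v).prod (wienerPair.map (planarBrownian 1)) :=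
    (indepFun_iff_map_prod_eq_prod_map_map hU.aemeasurable hZ.aemeasurable).1
      indepFun_unitBridge_planarBrownian_one
  have hGΛ : Measurable fun x ↦ G (Λ x) := hG.comp hΛm
  have step2 : ∫⁻ ω, G (Λ ((fun v : I ↦ unitBridge ω v), planarBrownian 1 ω)) ∂wienerPair =
      ∫⁻ η, ∫⁻ ξ, G (Λ (η, ξ)) ∂(wienerPair.map (planarBrownian 1))
        ∂(wienerPair.map fun ω (v : I) ↦ unitBridge ω v) := by
    rw [← lintegral_prod _ hGΛ.aemeasurable, ← hprod, lintegral_map hGΛ (hU.prodMk hZ)]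
  rw [step2]
  -- the law of `Z_1` as a density, and back to `ω`
  have hin : ∀ η : I → ℂ, Measurable fun ξ ↦ G (Λ (η, ξ)) := fun η ↦
    hGΛ.comp (measurable_const.prodMk measurable_id)
  have step3 : ∀ η : I → ℂ, ∫⁻ ξ, G (Λ (η, ξ)) ∂(wienerPair.map (planarBrownian 1)) =
      ∫⁻ ξ, heat 1 ξ * G (Λ (η, ξ)) := by
    intro η
    have hd : Measurable fun w : ℂ ↦ gaussianPDF 0 1 w.re * gaussianPDF 0 1 w.im := by
      have e : (fun w : ℂ ↦ gaussianPDF 0 1 w.re * gaussianPDF 0 1 w.im) = heat 1 :=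
        funext fun w ↦ (heat_one_eq w).symm
      rw [e]; exact measurable_heat_right 1
    rw [map_planarBrownian_one_eq_withDensity, lintegral_withDensity_eq_lintegral_mul _ hd (hin η)]
    refine lintegral_congr fun ξ ↦ ?_
    rw [Pi.mul_apply, heat_one_eq]
  simp_rw [step3]
  have hM : Measurable fun x : (I → ℂ) × ℂ ↦ heat 1 x.2 * G (Λ x) :=
    ((measurable_heat_right 1).comp measurable_snd).mul hGΛ
  have step5 : ∫⁻ η, (∫⁻ ξ, heat 1 ξ * G (Λ (η, ξ))) ∂(wienerPair.map fun ω (v : I) ↦ unitBridge ω v) =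
      ∫⁻ ω, (∫⁻ ξ, heat 1 ξ * G (Λ ((fun v : I ↦ unitBridge ω v), ξ))) ∂wienerPair := by
    have h := lintegral_map (μ := wienerPair) (hM.lintegral_prod_right' (ν := volume)) hU
    simpa only using h
  rw [step5]
  -- Step 3: swap and change variables `w = z + √t ξ`
  have hswap : ∫⁻ ω, (∫⁻ ξ, heat 1 ξ * G (Λ ((fun v : I ↦ unitBridge ω v), ξ))) ∂wienerPair =
      ∫⁻ ξ, ∫⁻ ω, heat 1 ξ * G (Λ ((fun v : I ↦ unitBridge ω v), ξ)) ∂wienerPair :=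
    lintegral_lintegral_swap (f := fun ω ξ ↦ heat 1 ξ * G (Λ ((fun v : I ↦ unitBridge ω v), ξ)))
      (by exact (hM.comp ((hU.comp measurable_fst).prodMk measurable_snd)).aemeasurable)
  rw [hswap]
  have hne : ∀ ξ, heat 1 ξ ≠ ∞ := fun ξ ↦ ENNReal.mul_ne_top ENNReal.ofReal_ne_top ENNReal.ofReal_ne_top
  have hin' : ∀ ξ, Measurable fun ω : WienerPair ↦ G (Λ ((fun v : I ↦ unitBridge ω v), ξ)) := fun ξ ↦
    hGΛ.comp (hU.prodMk measurable_const)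
  have step4 : ∀ ξ, ∫⁻ ω, heat 1 ξ * G (Λ ((fun v : I ↦ unitBridge ω v), ξ)) ∂wienerPair =
      heat 1 ξ * ∫⁻ ω, G (Λ ((fun v : I ↦ unitBridge ω v), ξ)) ∂wienerPair := fun ξ ↦
    lintegral_const_mul _ (hin' ξ)
  simp_rw [step4]
  -- the target function of `w`
  set F : ℂ → ℝ≥0∞ := fun w ↦ ∫⁻ ω, G (bridgeFun z w (t, ω)) ∂wienerPair with hF
  have hFm : Measurable F := by
    have h : Measurable fun p : ℂ × WienerPair ↦ G (bridgeFun z p.1 (t, p.2)) :=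
      hG.comp (measurable_bridgeFun.comp (measurable_const.prodMk (measurable_fst.prodMk
        (measurable_const.prodMk measurable_snd))))
    exact h.lintegral_prod_right'
  have key : ∀ ξ, ∫⁻ ω, G (Λ ((fun v : I ↦ unitBridge ω v), ξ)) ∂wienerPair = F (z + (Real.sqrt t : ℂ) * ξ) := by
    intro ξ
    simp only [hF]
    refine lintegral_congr fun ω ↦ ?_
    congr 1
    funext v
    simp only [hΛ, bridgeFun]
    ring
  simp_rw [key]
  rw [lintegral_heat_affine ht one_pos z hFm, mul_one]

/-! ### On path space `C([0,1], ℂ)` -/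

section PathSpace

variable [MeasurableSpace C(I, ℂ)] [BorelSpace C(I, ℂ)]

/-- The Borel σ-algebra of `C([0,1], ℂ)` is the pull-back of the product σ-algebra.
[cite: Billingsley1999, Example 1.3] -/
theorem measurableSpace_continuousMap_eq_comap :
    (‹MeasurableSpace C(I, ℂ)› : MeasurableSpace C(I, ℂ)) =
      MeasurableSpace.pi.comap fun (f : C(I, ℂ)) (u : I) ↦ f u := by
  rw [← Process.iSup_comap_eval_eq_comap_pi, ← Process.borel_continuousMap_eq_iSup_comap_eval,
    ← BorelSpace.measurable_eq (α := C(I, ℂ))]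

/-- **Doob–Dynkin on path space**: a Borel function of a continuous path on `[0,1]` is a
measurable function of its values (Mathlib `Measurable.exists_eq_measurable_comp`). [folklore] -/
theorem exists_eq_comp_coeFn {G : C(I, ℂ) → ℝ≥0∞} (hG : Measurable G) :
    ∃ G' : (I → ℂ) → ℝ≥0∞, Measurable G' ∧ G = G' ∘ fun (f : C(I, ℂ)) (u : I) ↦ f u := by
  have hG' : Measurable[MeasurableSpace.pi.comap fun (f : C(I, ℂ)) (u : I) ↦ f u] G := by
    rw [← measurableSpace_continuousMap_eq_comap]; exact hG
  exact hG'.exists_eq_measurable_comp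

/-- The bridge `bridgeFun z w q` as a continuous path. [folklore] -/
def bridgeFunCM (z w : ℂ) (q : ℝ × WienerPair) : C(I, ℂ) :=
  ⟨bridgeFun z w q, by unfold bridgeFun unitBridge; fun_prop⟩

omit [MeasurableSpace C(I, ℂ)] [BorelSpace C(I, ℂ)] in
/-- Coercion of `bridgeFunCM`. [folklore] -/
@[simp] theorem coe_bridgeFunCM (z w : ℂ) (q : ℝ × WienerPair) :
    ⇑(bridgeFunCM z w q) = bridgeFun z w q := rfl

/-- Measurability of `bridgeFunCM` in (start, end, duration, sample). [folklore] -/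
theorem measurable_bridgeFunCM :
    Measurable fun r : ℂ × ℂ × ℝ × WienerPair ↦ bridgeFunCM r.1 r.2.1 r.2.2 :=
  measurable_of_eval fun v ↦ by
    have := (measurable_pi_apply v).comp measurable_bridgeFun
    exact this

/-- **The initial segment of duration `t` of planar Brownian motion from `z`, in unit time**, as a
continuous path: `v ↦ z + Z_{tv}`. [folklore] -/
def segmentCM (z : ℂ) (t : ℝ) (ω : WienerPair) : C(I, ℂ) :=
  ⟨fun v ↦ z + planarBrownian (t.toNNReal * (v : ℝ).toNNReal) ω, by
    have h : Continuous fun v : I ↦ t.toNNReal * (v : ℝ).toNNReal :=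
      continuous_const.mul (continuous_real_toNNReal.comp continuous_subtype_val)
    exact continuous_const.add ((continuous_planarBrownian ω).comp h)⟩

omit [MeasurableSpace C(I, ℂ)] [BorelSpace C(I, ℂ)] in
/-- Value of `segmentCM`. [folklore] -/
@[simp] theorem segmentCM_apply (z : ℂ) (t : ℝ) (ω : WienerPair) (v : I) :
    segmentCM z t ω v = z + planarBrownian (t.toNNReal * (v : ℝ).toNNReal) ω := rfl

/-- Measurability of `segmentCM`. [folklore] -/
theorem measurable_segmentCM (z : ℂ) (t : ℝ) : Measurable (segmentCM z t) :=
  measurable_of_eval fun _ ↦ (measurable_planarBrownian _).const_add _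

/-- **The segment law on path space**: for `t > 0` and Borel `G ≥ 0` on `C([0,1], ℂ)`,
`E[G(v ↦ z + Z_{tv})] = ∫ p_t(w − z) E[G(bridgeFunCM z w (t, ·))] dA(w)`.
[cite: Lawler2005ConformallyInvariant, §5.2] -/
theorem lintegral_segmentCM_eq {t : ℝ} (ht : 0 < t) (z : ℂ) {G : C(I, ℂ) → ℝ≥0∞} (hG : Measurable G) :
    ∫⁻ ω, G (segmentCM z t ω) ∂wienerPair =
      ∫⁻ w, heat t (w - z) * ∫⁻ ω, G (bridgeFunCM z w (t, ω)) ∂wienerPair := by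
  obtain ⟨G', hG', rfl⟩ := exists_eq_comp_coeFn hG
  exact lintegral_segment_eq ht z hG'

end PathSpace

end BrownianLoop

end Literature.Probability.RandomPlanarGeometry

end
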